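import Summits.ResolutionOfSingularities.ResolutionOfSingularities.Theorems.FrobeniusLadderFRationalResolutionHfinOfChartData
import Literature.RingTheory.CompleteLocalRings.CoefficientField
import HarnessLib

/-!
# Crux `FrobeniusLadder.FRationalResolution` (stmt-ResolutionOfSingularities-15317), line `redirect`,
# stub `stub_diagonalizableQuotientResolution` — `hfin` FROM CHART DATA ALONE (the coefficient field supplied by Cohen, Matsumura 28.3)

`…HfinOfChartData.hfin_of_chartData` (p840438) takes a coefficient field `j : κ → E`. For a complete local ring CONTAINING A FIELD (e.g. `Ê`, which is a
`K'`-algebra) Cohen's theorem (tree `Literature.RingTheory.CompleteLocalRings.exists_ringHom_comp_residue_eq_id_of_subring`, Matsumura 28.3 (ii)) provides one,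
so the hypothesis disappears:

* `isLocalHom_of_field` — a ring map from a field to a nontrivial ring is a local homomorphism;
* ★★★ `hfin_of_chartData_of_subfield` / `hfin_of_chartData_of_algebra` — complete Noetherian local `E` containing a field (resp. an algebra over a field)
  + d = 0 Kato chart data by the ℤ/r-weight kernel `P` with `dim E = rank P` ⇒ finitely many trace ideals of nonzero divisorial ideals.

Honest label: assembly toward ONE leaf stub (no stub, crux or summit closed). No definitions, no named facts, no sorry.
[cite: Matsumura1987, Thm. 28.3 (ii); Thm. 8.4] [cite: Kato1994, Thm. (3.2)]
-/

noncomputable section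

-- single-problem summit: the doubled namespace component is forced
set_option linter.dupNamespace false

open IsLocalRing Literature.RingTheory.MvPowerSeries Literature.RingTheory.MvPowerSeries.monoidPowerSeries
  Literature.RingTheory.CompleteLocalRings
open Summit.ResolutionOfSingularities.ResolutionOfSingularities.Theorems.FRationalResolution

namespace Summit.ResolutionOfSingularities.ResolutionOfSingularities.Theorems.FRationalResolution.HfinOfChartDataField

/-- A ring map from a field to a nontrivial ring is a local homomorphism. [folklore] -/
theorem isLocalHom_of_field {κ E : Type} [Field κ] [CommRing E] [Nontrivial E] (j : κ →+* E) : IsLocalHom j := by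
  refine ⟨fun x hx => ?_⟩
  by_cases h : x = 0
  · subst h
    rw [map_zero] at hx
    exact (not_isUnit_zero hx).elim
  · exact isUnit_iff_ne_zero.mpr h

/-- ★★★ **`hfin` from chart data, for complete local rings containing a field.** [cite: Matsumura1987, Thm. 28.3 (ii)] [cite: Kato1994, Thm. (3.2)] -/
theorem hfin_of_chartData_of_subfield {E : Type} [CommRing E] [IsLocalRing E] [IsNoetherianRing E] [IsAdicComplete (maximalIdeal E) E]
    (k₀ : Subring E) (hk₀ : IsField k₀)
    (n r : ℕ) [NeZero r] (w : Fin n → ZMod r) (P : AddSubmonoid (Fin n →₀ ℕ))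
    (hP : ∀ m : Fin n →₀ ℕ, m ∈ P ↔ Finsupp.weight w m = 0) (hPfg : P.FG)
    (φ : (Fin n →₀ ℕ) → E) (hφ0 : φ 0 = 1) (hφadd : ∀ a ∈ P, ∀ b ∈ P, φ (a + b) = φ a * φ b)
    (hφm : ∀ p ∈ P, p ≠ 0 → φ p ∈ maximalIdeal E) (hgen : maximalIdeal E ≤ Ideal.span (φ '' {p | p ∈ P ∧ p ≠ 0}))
    (hdim : ringKrullDim E = rank P) :
    Set.Finite {T : Ideal E | ∃ I : Ideal E,
      (I ≠ ⊥ ∧ ∀ x : E, (∀ a b : E, (∀ y ∈ I, b * y ∈ Ideal.span ({a} : Set E)) → b * x ∈ Ideal.span ({a} : Set E)) → x ∈ I) ∧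
      T = ⨆ ψ : I →ₗ[E] E, LinearMap.range ψ} := by
  obtain ⟨σ, hσ⟩ := exists_ringHom_comp_residue_eq_id_of_subring E k₀ hk₀
  haveI : IsLocalHom σ := isLocalHom_of_field σ
  have hres : ∀ a : E, ∃ l : ResidueField E, a - σ l ∈ maximalIdeal E := fun a =>
    ⟨residue E a, by rw [← residue_eq_zero_iff, map_sub, hσ, sub_self]⟩
  exact HfinOfChartData.hfin_of_chartData (ResidueField E) σ hres n r w P hP hPfg φ hφ0 hφadd hφm hgen hdim

/-- ★★★ **`hfin` from chart data, for complete local algebras over a field** (e.g. `Ê` over `K'`). [cite: Matsumura1987, Thm. 28.3 (ii)]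
[cite: Kato1994, Thm. (3.2)] -/
theorem hfin_of_chartData_of_algebra {E : Type} [CommRing E] [IsLocalRing E] [IsNoetherianRing E] [IsAdicComplete (maximalIdeal E) E]
    (K' : Type) [Field K'] [Algebra K' E]
    (n r : ℕ) [NeZero r] (w : Fin n → ZMod r) (P : AddSubmonoid (Fin n →₀ ℕ))
    (hP : ∀ m : Fin n →₀ ℕ, m ∈ P ↔ Finsupp.weight w m = 0) (hPfg : P.FG)
    (φ : (Fin n →₀ ℕ) → E) (hφ0 : φ 0 = 1) (hφadd : ∀ a ∈ P, ∀ b ∈ P, φ (a + b) = φ a * φ b)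
    (hφm : ∀ p ∈ P, p ≠ 0 → φ p ∈ maximalIdeal E) (hgen : maximalIdeal E ≤ Ideal.span (φ '' {p | p ∈ P ∧ p ≠ 0}))
    (hdim : ringKrullDim E = rank P) :
    Set.Finite {T : Ideal E | ∃ I : Ideal E,
      (I ≠ ⊥ ∧ ∀ x : E, (∀ a b : E, (∀ y ∈ I, b * y ∈ Ideal.span ({a} : Set E)) → b * x ∈ Ideal.span ({a} : Set E)) → x ∈ I) ∧
      T = ⨆ ψ : I →ₗ[E] E, LinearMap.range ψ} := by
  have hinj : Function.Injective (algebraMap K' E) := (algebraMap K' E).injective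
  have hk₀ : IsField (algebraMap K' E).range :=
    MulEquiv.isField (Field.toIsField K')
      (RingEquiv.ofBijective (algebraMap K' E).rangeRestrict
        ⟨fun x y h => hinj (congrArg Subtype.val h), (algebraMap K' E).rangeRestrict_surjective⟩).symm.toMulEquiv
  exact hfin_of_chartData_of_subfield (algebraMap K' E).range hk₀ n r w P hP hPfg φ hφ0 hφadd hφm hgen hdim

end Summit.ResolutionOfSingularities.ResolutionOfSingularities.Theorems.FRationalResolution.HfinOfChartDataField

end
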